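import Mathlib.Analysis.Analytic.Basic
import Mathlib.Analysis.Analytic.Constructions
import Mathlib.MeasureTheory.Measure.Lebesgue.Basic
import Mathlib.MeasureTheory.Function.LocallyIntegrable
import Mathlib.LinearAlgebra.Matrix.ToLin
import Mathlib.LinearAlgebra.Determinant
import Mathlib.Topology.Algebra.Module.FiniteDimension
import Literature.NumberTheory.Transcendental.KZCalculus
import Literature.NumberTheory.Transcendental.NashCubes
import HarnessLib

/-!
# The cubical sub-calculus of the Kontsevich–Zagier calculus: tame cubes and the cubical span

Definition request `defn-KZ.cubicalSpan` (topic `Literature/NumberTheory/Transcendental`; crux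
`ReducedPeriodRing` = item `stmt-KontsevichZagierPeriods-3929` of route
`KontsevichZagierPeriods/FurushoPentagon`, line `effective-end-monoid`). The line works inside the
sub-calculus of the Kontsevich–Zagier calculus of moves (`KZCalculus.lean`: `KZ.IntegralRep`,
`KZ.FormalRep`, `KZ.of`, `KZ.relations`) generated by *tame cube* representations — domain the closed
unit cube `[0,1]ⁿ`, integrand real-analytic near the closed cube — and four families of moves between
them. This is the tree's rendering of Ayoub's "compact presentation" of the ring of effective periods
by integrals `∫_{[0,1]ⁿ} f` of functions holomorphic near the closed unit polydisc and algebraic over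
`ℚ(z₁, …, zₙ)`, with the Stokes-type relations `∂f/∂zᵢ − f|_{zᵢ=1} + f|_{zᵢ=0}`
[Ayoub 2014, Def. 9, Def. 10, Prop. 11, Rem. 13], written in Kontsevich–Zagier's own language of
rules (1) additivity, (2) change of variables, (3) Newton–Leibniz [Kontsevich–Zagier 2001, §1.2]
(compare the linearity relation of effective formal periods, Huber–Müller-Stach, Part III draft 2015,
Def. 12.1.1 (1)).

## Main definitions

* `KZ.cube n` — the closed unit cube `{x : Fin n → ℝ | ∀ i, 0 ≤ x i ∧ x i ≤ 1}`, in exactly this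
  set-builder form (see the design notes); `KZ.cube_eq_closedUnitCube : cube n = closedUnitCube n`
  (`= Set.Icc 0 1`, `NashCubes.lean`) transports compactness, measurability, semialgebraicity,
  `volume (cube n) = 1`; `KZ.cube_succ_eq` displays `cube (n + 1)` as the band
  `{z | Fin.init z ∈ cube n ∧ 0 ≤ z (Fin.last n) ≤ 1}` of the Newton–Leibniz move.
* `KZ.IntegralRep.IsTameCube r` — `r.domain = cube n ∧ AnalyticOnNhd ℝ r.integrand (cube n)`;
  `KZ.IntegralRep.tameCube f hf hsa` — the representation `[[0,1]ⁿ, f]` of a function analytic near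
  the cube and `ℚ`-semialgebraic on it (integrable because continuous on a compact set).
* the four generator families, each a `Set KZ.FormalRep`, written VERBATIM (up to unfolding `cube`)
  as in the registered stubs `stub_cubicalSound` / `stub_cubicalCoherence` / `stub_cubicalSqrtClosed`
  of the crux item:
  - `KZ.cubicalLinGens` — linearity of the integrand on a cube: `[r] − [r₁] − [r₂]`,
    `f = f₁ + f₂` on `[0,1]ⁿ` (rule (1));
  - `KZ.cubicalStokesGens` — Newton–Leibniz along the last coordinate of the cube:
    `[[0,1]ⁿ⁺¹, ∂ₜF] − [[0,1]ⁿ, F(·,1) − F(·,0)]` with `F` analytic near the cube and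
    `ℚ`-semialgebraic on it (rule (3); Ayoub's relation (a));
  - `KZ.cubicalCovGens` — change of variables along a `ℚ`-semialgebraic map `Φ` of the closed cube
    ONTO itself, injective on the cube, differentiable within the cube with derivative `Φ'`, with
    analytic coordinates, `f = (f' ∘ Φ) · |det Φ'|` on the cube (rule (2); the hypotheses are those of
    `KZ.changeOfVariablesRel` plus `Φ '' cube = cube` and analyticity; no condition on the inverse);
  - `KZ.cubicalSubdivGens` — dyadic subdivision along one coordinate `i`:
    `[r] − [r₁] − [r₂]` with `f₁ x = ½ f (x with xᵢ ↦ xᵢ/2)`, `f₂ x = ½ f (x with xᵢ ↦ (1+xᵢ)/2)`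
    (rules (1) in the domain and (2));
* `KZ.cubicalSpan : AddSubgroup KZ.FormalRep` — the subgroup generated by the union of the four.

## Main statements (all proved)

* `KZ.cubicalLinGens_subset_integrandAddRel`, `KZ.cubicalCovGens_subset_changeOfVariablesRel`,
  `KZ.cubicalStokesGens_subset_newtonLeibnizRel` (with `a = 0`, `b = 1`): three of the four families
  are literally instances of the moves of `KZCalculus.lean`, hence lie in `KZ.relations`
  (`KZ.cubicalLinGens_subset_relations`, …).
* `KZ.cubicalSubdivGens_subset_relations`: the subdivision move is the sum of a domain-additivity
  move across the null hyperplane `xᵢ = ½` (`KZ.lowerHalfCube`, `KZ.upperHalfCube`) and two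
  change-of-variables moves along the affine rescalings `KZ.lowerHalfMap`, `KZ.upperHalfMap`
  (derivative `KZ.halfScaleCLM i = diag(1, …, ½, …, 1)`, `det = ½`).
* `KZ.cubicalSpan_le_relations : cubicalSpan ≤ relations` — **soundness of the cubical
  sub-calculus**; definitionally the registered stub `stub_cubicalSound` of the crux item (so that stub
  is settled by this file); `KZ.eval_eq_zero_of_mem_cubicalSpan`. No completeness statement
  (`stub_cubicalCoherence`, `stub_cubicalSqrtClosed`, `stub_cubeCompilation`) is claimed here.
* `KZ.mem_cubicalLinGens` etc.: introduction rules phrased with `IsTameCube`.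

## References

* M. Kontsevich, D. Zagier, *Periods*, in: Mathematics Unlimited — 2001 and Beyond, Springer (2001),
  771–808, §1.2 (rules (1)–(3); "in the case of multi-dimensional integrals one puts the Jacobian … in
  rule 2) and replaces the Newton–Leibniz formula by Stokes's formula in rule 3)").
  [`KontsevichZagierPeriods2001`]
* J. Ayoub, *Periods and the conjectures of Grothendieck and Kontsevich–Zagier*, EMS Newsletter 91
  (2014) 12–18, §2.2 "A compact presentation of the ring of abstract periods": Def. 9 (`𝒪_alg(𝔻̄ⁿ)`),
  Def. 10 (`𝒫^eff = 𝒪_alg(𝔻̄^∞)/⟨∂f/∂zᵢ − f|_{zᵢ=1} + f|_{zᵢ=0}⟩`), Prop. 11 (`𝒫 ≅ 𝒫_KZ`), Rem. 13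
  (`Ev [f] = ∫_{[0,1]ⁿ} f`). [`Ayoub2014`]
* A. Huber, S. Müller-Stach, *Periods and Nori Motives, Part III* (draft 2015), Def. 12.1.1
  (effective formal periods; relation (1) linearity). [`HuberMullerStachPeriodsIII2015`]

## Design notes

* `KZ.cube n` is deliberately the literal `{x | ∀ i, 0 ≤ x i ∧ x i ≤ 1}` and the four generator
  families are deliberately flat right-nested conjunctions in the order of the registered stubs, so
  that the stubs (registered in unfolded form) are restated through these definitions by `Iff.rfl`:
  `cubicalSpan ≤ relations` is definitionally the statement of `stub_cubicalSound` (checked by `Iff.rfl`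
  in the scratch file of this request). The tree's `closedUnitCube n = Set.Icc 0 1` (`NashCubes.lean`)
  is propositionally but not definitionally equal (`cube_eq_closedUnitCube`); `IsTameCube r` is
  propositionally but not definitionally the first two conjuncts of each block, whence the separate
  introduction rules `mem_cubical*Gens`.
* Nothing is asserted: every declaration is a definition with a body or a proved theorem (D-0014).
* This particular four-family presentation is fixed by the route line, not by a published text; the
  docstrings cite the printed rules each family instantiates.
-/

noncomputable section

open MeasureTheory Set MvPolynomial
open Literature.ModelTheory.ExponentialFields (IsSemialgebraic)

namespace Literature.NumberTheory.Transcendental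

namespace KZ

/-! ### The closed unit cube -/

/-- The closed unit cube `[0,1]ⁿ = {x : ℝⁿ | ∀ i, 0 ≤ xᵢ ≤ 1}`, the domain of integration of Ayoub's
presentation of effective periods (`Ev [f] = ∫_{[0,1]ⁿ} f`), written coordinatewise in the literal
set-builder form of the registered stubs of crux `ReducedPeriodRing`.
[Ayoub 2014, Def. 10 and Rem. 13] [cite: Ayoub2014, Def. 10 and Rem. 13] -/
def cube (n : ℕ) : Set (Fin n → ℝ) := {x | ∀ i, 0 ≤ x i ∧ x i ≤ 1}

variable {n : ℕ}

/-- Membership in the closed unit cube (definitional unfolding). [folklore] -/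
theorem mem_cube {x : Fin n → ℝ} : x ∈ cube n ↔ ∀ i, 0 ≤ x i ∧ x i ≤ 1 := Iff.rfl

/-- `KZ.cube n` is the closed unit cube `closedUnitCube n = Set.Icc 0 1` of `NashCubes.lean`.
[folklore] -/
theorem cube_eq_closedUnitCube (n : ℕ) : cube n = closedUnitCube n := by
  ext x
  simp only [mem_cube, mem_closedUnitCube_iff, mem_Icc]

/-- `KZ.cube n = Set.Icc 0 1` for the product order on `Fin n → ℝ`. [folklore] -/
theorem cube_eq_Icc (n : ℕ) : cube n = Icc (0 : Fin n → ℝ) 1 := cube_eq_closedUnitCube n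

/-- `KZ.cube n` as a product of intervals. [folklore] -/
theorem cube_eq_pi (n : ℕ) : cube n = Set.pi univ fun _ => Icc (0 : ℝ) 1 := by
  ext x
  simp only [mem_cube, mem_univ_pi, mem_Icc]

/-- In dimension `0` the cube is the whole (one-point) space. [folklore] -/
@[simp] theorem cube_zero : cube 0 = univ :=
  eq_univ_of_forall fun _ => mem_cube.2 fun i => i.elim0

/-- The closed unit cube is compact. [folklore] -/
theorem isCompact_cube : IsCompact (cube n) := by
  rw [cube_eq_Icc]; exact isCompact_Icc

/-- The closed unit cube is closed. [folklore] -/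
theorem isClosed_cube : IsClosed (cube n) := isCompact_cube.isClosed

/-- The closed unit cube is Lebesgue measurable. [folklore] -/
theorem measurableSet_cube : MeasurableSet (cube n) := isClosed_cube.measurableSet

/-- The closed unit cube is `ℚ`-semialgebraic (`0 ≤ xᵢ`, `0 ≤ 1 − xᵢ`). [folklore] -/
theorem isSemialgebraic_cube : IsSemialgebraic ℚ (cube n) := by
  rw [cube_eq_closedUnitCube]; exact isSemialgebraic_closedUnitCube

/-- The closed unit cube has Lebesgue measure `1`. [folklore] -/
@[simp] theorem volume_cube : volume (cube n) = 1 := by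
  rw [cube_eq_Icc, Real.volume_Icc_pi]
  simp

/-- The closed unit cube has (real-valued) Lebesgue measure `1`. [folklore] -/
@[simp] theorem volume_real_cube : volume.real (cube n) = 1 := by
  simp [measureReal_def]

/-- The open unit cube `(0,1)ⁿ` of `NashCubes.lean` lies in `KZ.cube n`. [folklore] -/
theorem openUnitCube_subset_cube : openUnitCube n ⊆ cube n := by
  rw [cube_eq_closedUnitCube]; exact openUnitCube_subset_closedUnitCube

/-- The cube `[0,1]ⁿ⁺¹` is the band over `[0,1]ⁿ` between the constant functions `0 ≤ 1` along the
last coordinate — the shape of the domain of the Newton–Leibniz move `KZ.newtonLeibnizRel`.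
[Kontsevich–Zagier 2001, §1.2 rule (3)] [cite: KontsevichZagierPeriods2001, §1.2 rule (3)] -/
theorem cube_succ_eq (n : ℕ) :
    cube (n + 1) =
      {z | (Fin.init z : Fin n → ℝ) ∈ cube n ∧ 0 ≤ z (Fin.last n) ∧ z (Fin.last n) ≤ 1} := by
  ext z
  simp only [mem_cube, mem_setOf_eq, Fin.forall_fin_succ', Fin.init]

/-- Appending a last coordinate: `(x, t) ∈ [0,1]ⁿ⁺¹ ↔ x ∈ [0,1]ⁿ ∧ 0 ≤ t ≤ 1`. [folklore] -/
theorem snoc_mem_cube_iff {x : Fin n → ℝ} {t : ℝ} :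
    (Fin.snoc x t : Fin (n + 1) → ℝ) ∈ cube (n + 1) ↔ x ∈ cube n ∧ 0 ≤ t ∧ t ≤ 1 := by
  rw [cube_succ_eq]
  simp only [mem_setOf_eq, Fin.init_snoc, Fin.snoc_last]

/-- Changing one coordinate to a value in `[0,1]` stays in the cube (used by the subdivision maps
`x ↦ (x with xᵢ ↦ xᵢ/2)`, `x ↦ (x with xᵢ ↦ (1 + xᵢ)/2)`). [folklore] -/
theorem update_mem_cube {x : Fin n → ℝ} (hx : x ∈ cube n) (i : Fin n) {t : ℝ} (ht₀ : 0 ≤ t)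
    (ht₁ : t ≤ 1) : Function.update x i t ∈ cube n := by
  intro j
  rcases eq_or_ne j i with rfl | hj
  · simpa using And.intro ht₀ ht₁
  · simpa [Function.update_of_ne hj] using mem_cube.1 hx j

/-! ### Tame cube representations -/

namespace IntegralRep

/-- An integral representation is a **tame cube** if its domain is the closed unit cube `[0,1]ⁿ` and
its integrand is real-analytic at every point of the closed cube (hence on an open neighbourhood of
it). Together with the `ℚ`-semialgebraicity of the integrand on the domain (a field of
`KZ.IntegralRep`) this is the tree's analogue of Ayoub's generators `f ∈ 𝒪_alg(𝔻̄ⁿ)` (power series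
with radius of convergence `> 1`, algebraic over `ℚ(z₁, …, zₙ)`), evaluated by `∫_{[0,1]ⁿ} f`.
[Ayoub 2014, Def. 9, Def. 10, Rem. 13] [cite: Ayoub2014, Def. 9–10 and Rem. 13] -/
def IsTameCube (r : IntegralRep n) : Prop :=
  r.domain = cube n ∧ AnalyticOnNhd ℝ r.integrand (cube n)

/-- Unfolding of `IsTameCube` (definitional). [folklore] -/
theorem isTameCube_iff (r : IntegralRep n) :
    r.IsTameCube ↔ r.domain = cube n ∧ AnalyticOnNhd ℝ r.integrand (cube n) := Iff.rfl

namespace IsTameCube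

variable {r : IntegralRep n}

/-- The domain of a tame cube representation is the closed unit cube. [folklore] -/
theorem domain_eq (h : r.IsTameCube) : r.domain = cube n := h.1

/-- The integrand of a tame cube representation is analytic near the closed cube. [folklore] -/
theorem analyticOnNhd (h : r.IsTameCube) : AnalyticOnNhd ℝ r.integrand (cube n) := h.2

/-- The integrand of a tame cube representation is continuous on the closed cube. [folklore] -/
theorem continuousOn (h : r.IsTameCube) : ContinuousOn r.integrand (cube n) := h.2.continuousOn

/-- The integrand of a tame cube representation is `ℚ`-semialgebraic on the closed cube. [folklore] -/
theorem isSemialgebraicFunOn (h : r.IsTameCube) : IsSemialgebraicFunOn ℚ (cube n) r.integrand :=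
  h.1 ▸ r.isSemialgebraicFunOn_integrand

/-- The integrand of a tame cube representation is absolutely integrable on the closed cube.
[folklore] -/
theorem integrableOn (h : r.IsTameCube) : IntegrableOn r.integrand (cube n) :=
  h.1 ▸ r.integrableOn

/-- The value of a tame cube representation is `∫_{[0,1]ⁿ} f`. [Ayoub 2014, Rem. 13] [cite: Ayoub2014, Rem. 13] -/
theorem value_eq (h : r.IsTameCube) : r.value = ∫ x in cube n, r.integrand x := by
  rw [IntegralRep.value, h.1]

end IsTameCube

/-- The tame cube representation `[[0,1]ⁿ, f]` of a function `f` analytic near the closed cube and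
`ℚ`-semialgebraic on it; absolute convergence holds because `f` is continuous on the compact cube.
[Ayoub 2014, Def. 10 and Rem. 13] [cite: Ayoub2014, Def. 10 and Rem. 13] -/
def tameCube (f : (Fin n → ℝ) → ℝ) (hf : AnalyticOnNhd ℝ f (cube n))
    (hsa : IsSemialgebraicFunOn ℚ (cube n) f) : IntegralRep n where
  domain := cube n
  integrand := f
  isSemialgebraic_domain := isSemialgebraic_cube
  isSemialgebraicFunOn_integrand := hsa
  integrableOn := hf.continuousOn.integrableOn_compact isCompact_cube

/-- The domain of `tameCube f` is the closed unit cube. [folklore] -/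
@[simp] theorem tameCube_domain (f : (Fin n → ℝ) → ℝ) (hf : AnalyticOnNhd ℝ f (cube n))
    (hsa : IsSemialgebraicFunOn ℚ (cube n) f) : (tameCube f hf hsa).domain = cube n := rfl

/-- The integrand of `tameCube f` is `f`. [folklore] -/
@[simp] theorem tameCube_integrand (f : (Fin n → ℝ) → ℝ) (hf : AnalyticOnNhd ℝ f (cube n))
    (hsa : IsSemialgebraicFunOn ℚ (cube n) f) : (tameCube f hf hsa).integrand = f := rfl

/-- `tameCube f` is a tame cube representation. [folklore] -/
theorem isTameCube_tameCube (f : (Fin n → ℝ) → ℝ) (hf : AnalyticOnNhd ℝ f (cube n))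
    (hsa : IsSemialgebraicFunOn ℚ (cube n) f) : (tameCube f hf hsa).IsTameCube :=
  ⟨rfl, hf⟩

/-- The value of `tameCube f` is `∫_{[0,1]ⁿ} f`. [Ayoub 2014, Rem. 13] [cite: Ayoub2014, Rem. 13] -/
@[simp] theorem value_tameCube (f : (Fin n → ℝ) → ℝ) (hf : AnalyticOnNhd ℝ f (cube n))
    (hsa : IsSemialgebraicFunOn ℚ (cube n) f) :
    (tameCube f hf hsa).value = ∫ x in cube n, f x := rfl

end IntegralRep

/-! ### The four families of cubical moves

Each family is written exactly as in the registered stubs of crux `ReducedPeriodRing` (line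
`effective-end-monoid`), with `cube n` abbreviating the literal `{x : Fin n → ℝ | ∀ i, 0 ≤ x i ∧ x i ≤ 1}`;
in particular the tame-cube hypotheses appear as the two separate conjuncts `r.domain = cube n` and
`AnalyticOnNhd ℝ r.integrand (cube n)`, not as `r.IsTameCube`. -/

/-- **Cubical move (lin): linearity of the integrand on a cube.** For tame cube representations
`r, r₁, r₂` in the same dimension with `f = f₁ + f₂` on `[0,1]ⁿ`, the element `[r] − [r₁] − [r₂]`.
An instance of Kontsevich–Zagier's rule (1), additivity in the integrand
(`KZ.cubicalLinGens_subset_integrandAddRel`); compare relation (1) "linearity in `ω`" of effective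
formal periods [Huber–Müller-Stach III, Def. 12.1.1].
[Kontsevich–Zagier 2001, §1.2 rule (1)] [cite: KontsevichZagierPeriods2001, §1.2 rule (1)] -/
def cubicalLinGens : Set FormalRep :=
  {c | ∃ (n : ℕ) (r r₁ r₂ : IntegralRep n), r.domain = cube n ∧ AnalyticOnNhd ℝ r.integrand (cube n) ∧
    r₁.domain = cube n ∧ AnalyticOnNhd ℝ r₁.integrand (cube n) ∧
    r₂.domain = cube n ∧ AnalyticOnNhd ℝ r₂.integrand (cube n) ∧
    Set.EqOn r.integrand (r₁.integrand + r₂.integrand) (cube n) ∧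
    c = of r - of r₁ - of r₂}

/-- **Cubical move (stokes): Newton–Leibniz along the last coordinate of the cube.** For a tame cube
representation `r` in dimension `n + 1`, a tame cube representation `r'` in dimension `n`, and a
primitive `F : ℝⁿ⁺¹ → ℝ` analytic near `[0,1]ⁿ⁺¹` and `ℚ`-semialgebraic on it with
`∂/∂t F (x, t) = r.integrand (x, t)` for `x ∈ [0,1]ⁿ`, `t ∈ [0,1]`, and
`r'.integrand x = F (x, 1) − F (x, 0)` on `[0,1]ⁿ`: the element `[r] − [r']`, i.e.
`[[0,1]ⁿ⁺¹, ∂ₜF] − [[0,1]ⁿ, F(·,1) − F(·,0)]`. This is Ayoub's relation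
`∂f/∂zᵢ − f|_{zᵢ=1} + f|_{zᵢ=0}` (for the last variable) and an instance of Kontsevich–Zagier's
rule (3) with the constant bounds `a = 0 ≤ b = 1` (`KZ.cubicalStokesGens_subset_newtonLeibnizRel`).
[Ayoub 2014, Def. 10; Kontsevich–Zagier 2001, §1.2 rule (3)] [cite: Ayoub2014, Def. 10] -/
def cubicalStokesGens : Set FormalRep :=
  {c | ∃ (n : ℕ) (r : IntegralRep (n + 1)) (r' : IntegralRep n) (F : (Fin (n + 1) → ℝ) → ℝ),
    r.domain = cube (n + 1) ∧ AnalyticOnNhd ℝ r.integrand (cube (n + 1)) ∧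
    r'.domain = cube n ∧ AnalyticOnNhd ℝ r'.integrand (cube n) ∧
    AnalyticOnNhd ℝ F (cube (n + 1)) ∧ IsSemialgebraicFunOn ℚ (cube (n + 1)) F ∧
    (∀ x ∈ cube n, ∀ t ∈ Set.Icc (0 : ℝ) 1,
      HasDerivAt (fun s : ℝ => F (Fin.snoc x s)) (r.integrand (Fin.snoc x t)) t) ∧
    (∀ x ∈ cube n, r'.integrand x = F (Fin.snoc x 1) - F (Fin.snoc x 0)) ∧
    c = of r - of r'}

/-- **Cubical move (cov): change of variables along a self-map of the closed cube.** For tame cube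
representations `r, r'` in dimension `n`, a map `Φ : ℝⁿ → ℝⁿ` which is `ℚ`-semialgebraic on
`[0,1]ⁿ`, has derivative `Φ' x` within the cube at every point of the cube, is injective on the cube,
maps the cube ONTO the cube (`Φ '' [0,1]ⁿ = [0,1]ⁿ`) and has coordinates analytic near the cube, with
`r.integrand x = r'.integrand (Φ x) · |det Φ' x|` on the cube: the element `[r] − [r']`. These are the
hypotheses of `KZ.changeOfVariablesRel` (Kontsevich–Zagier's rule (2) with the Jacobian) specialised to
`σ = Φ '' σ = [0,1]ⁿ`, plus analyticity (`KZ.cubicalCovGens_subset_changeOfVariablesRel`); no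
hypothesis is made on the inverse map.
[Kontsevich–Zagier 2001, §1.2 rule (2)] [cite: KontsevichZagierPeriods2001, §1.2 rule (2)] -/
def cubicalCovGens : Set FormalRep :=
  {c | ∃ (n : ℕ) (r r' : IntegralRep n) (Φ : (Fin n → ℝ) → (Fin n → ℝ))
      (Φ' : (Fin n → ℝ) → ((Fin n → ℝ) →L[ℝ] (Fin n → ℝ))),
    r.domain = cube n ∧ AnalyticOnNhd ℝ r.integrand (cube n) ∧
    r'.domain = cube n ∧ AnalyticOnNhd ℝ r'.integrand (cube n) ∧
    IsSemialgebraicMapOn ℚ (cube n) Φ ∧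
    (∀ x ∈ cube n, HasFDerivWithinAt Φ (Φ' x) (cube n) x) ∧
    Set.InjOn Φ (cube n) ∧ Φ '' cube n = cube n ∧
    (∀ i : Fin n, AnalyticOnNhd ℝ (fun x : Fin n → ℝ => Φ x i) (cube n)) ∧
    (∀ x ∈ cube n, r.integrand x = r'.integrand (Φ x) * |(Φ' x).det|) ∧
    c = of r - of r'}

/-- **Cubical move (subdiv): dyadic subdivision along one coordinate.** For tame cube representations
`r, r₁, r₂` in dimension `n` and a coordinate `i`, with
`r₁.integrand x = ½ · r.integrand (x with xᵢ ↦ xᵢ/2)` and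
`r₂.integrand x = ½ · r.integrand (x with xᵢ ↦ (1 + xᵢ)/2)` on `[0,1]ⁿ` (the two halves
`{xᵢ ≤ ½}`, `{½ ≤ xᵢ}` of the cube rescaled to the whole cube, Jacobian `½`): the element
`[r] − [r₁] − [r₂]`. A composite of Kontsevich–Zagier's rule (1), additivity in the domain across the
null hyperplane `xᵢ = ½`, and rule (2) for the two affine rescalings
(`KZ.cubicalSubdivGens_subset_relations`).
[Kontsevich–Zagier 2001, §1.2 rules (1), (2)] [cite: KontsevichZagierPeriods2001, §1.2 rules (1)–(2)] -/
def cubicalSubdivGens : Set FormalRep :=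
  {c | ∃ (n : ℕ) (r r₁ r₂ : IntegralRep n) (i : Fin n), r.domain = cube n ∧
    AnalyticOnNhd ℝ r.integrand (cube n) ∧
    r₁.domain = cube n ∧ AnalyticOnNhd ℝ r₁.integrand (cube n) ∧
    r₂.domain = cube n ∧ AnalyticOnNhd ℝ r₂.integrand (cube n) ∧
    (∀ x ∈ cube n, r₁.integrand x = (1 / 2 : ℝ) * r.integrand (Function.update x i (x i / 2))) ∧
    (∀ x ∈ cube n, r₂.integrand x = (1 / 2 : ℝ) * r.integrand (Function.update x i ((1 + x i) / 2))) ∧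
    c = of r - of r₁ - of r₂}

/-- **The cubical span**: the subgroup of `KZ.FormalRep` generated by the four families of cubical
moves (linearity, Newton–Leibniz along the last coordinate, change of variables along self-maps of
the cube, dyadic subdivision) between tame cube representations — the sub-calculus of the
Kontsevich–Zagier calculus fixed by the line `effective-end-monoid` of crux `ReducedPeriodRing`, after
Ayoub's presentation of effective periods by the closed unit cube. Its soundness
`cubicalSpan ≤ KZ.relations` (`KZ.cubicalSpan_le_relations`) is, definitionally, the registered stub
`stub_cubicalSound`.
[Ayoub 2014, Def. 10; Kontsevich–Zagier 2001, §1.2] [cite: Ayoub2014, Def. 10] -/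
def cubicalSpan : AddSubgroup FormalRep :=
  AddSubgroup.closure (cubicalLinGens ∪ cubicalStokesGens ∪ cubicalCovGens ∪ cubicalSubdivGens)

/-! ### Elementary API -/

/-- The linearity moves lie in the cubical span. [folklore] -/
theorem cubicalLinGens_subset_cubicalSpan : cubicalLinGens ⊆ cubicalSpan := fun _ hc =>
  AddSubgroup.subset_closure (Or.inl (Or.inl (Or.inl hc)))

/-- The Newton–Leibniz moves lie in the cubical span. [folklore] -/
theorem cubicalStokesGens_subset_cubicalSpan : cubicalStokesGens ⊆ cubicalSpan := fun _ hc =>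
  AddSubgroup.subset_closure (Or.inl (Or.inl (Or.inr hc)))

/-- The change-of-variables moves lie in the cubical span. [folklore] -/
theorem cubicalCovGens_subset_cubicalSpan : cubicalCovGens ⊆ cubicalSpan := fun _ hc =>
  AddSubgroup.subset_closure (Or.inl (Or.inr hc))

/-- The subdivision moves lie in the cubical span. [folklore] -/
theorem cubicalSubdivGens_subset_cubicalSpan : cubicalSubdivGens ⊆ cubicalSpan := fun _ hc =>
  AddSubgroup.subset_closure (Or.inr hc)

/-- `cubicalSpan` is the smallest subgroup containing the four families. [folklore] -/
theorem cubicalSpan_le_iff {H : AddSubgroup FormalRep} :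
    cubicalSpan ≤ H ↔ cubicalLinGens ⊆ H ∧ cubicalStokesGens ⊆ H ∧ cubicalCovGens ⊆ H ∧
      cubicalSubdivGens ⊆ H := by
  simp only [cubicalSpan, AddSubgroup.closure_le, union_subset_iff, and_assoc]

section Intro

/-- Introduction rule for the linearity move, with tame-cube hypotheses bundled.
[Kontsevich–Zagier 2001, §1.2 rule (1)] [cite: KontsevichZagierPeriods2001, §1.2 rule (1)] -/
theorem mem_cubicalLinGens {r r₁ r₂ : IntegralRep n} (hr : r.IsTameCube) (h₁ : r₁.IsTameCube) (h₂ : r₂.IsTameCube)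
    (hadd : Set.EqOn r.integrand (r₁.integrand + r₂.integrand) (cube n)) :
    of r - of r₁ - of r₂ ∈ cubicalLinGens :=
  ⟨n, r, r₁, r₂, hr.1, hr.2, h₁.1, h₁.2, h₂.1, h₂.2, hadd, rfl⟩

/-- Introduction rule for the Newton–Leibniz move along the last coordinate, with tame-cube
hypotheses bundled. [Ayoub 2014, Def. 10] [cite: Ayoub2014, Def. 10] -/
theorem mem_cubicalStokesGens {r : IntegralRep (n + 1)} {r' : IntegralRep n}
    (hr : r.IsTameCube) (hr' : r'.IsTameCube) {F : (Fin (n + 1) → ℝ) → ℝ}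
    (hFa : AnalyticOnNhd ℝ F (cube (n + 1))) (hFs : IsSemialgebraicFunOn ℚ (cube (n + 1)) F)
    (hderiv : ∀ x ∈ cube n, ∀ t ∈ Set.Icc (0 : ℝ) 1,
      HasDerivAt (fun s : ℝ => F (Fin.snoc x s)) (r.integrand (Fin.snoc x t)) t)
    (hr'F : ∀ x ∈ cube n, r'.integrand x = F (Fin.snoc x 1) - F (Fin.snoc x 0)) :
    of r - of r' ∈ cubicalStokesGens :=
  ⟨n, r, r', F, hr.1, hr.2, hr'.1, hr'.2, hFa, hFs, hderiv, hr'F, rfl⟩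

/-- Introduction rule for the change-of-variables move along a self-map of the cube, with tame-cube
hypotheses bundled. [Kontsevich–Zagier 2001, §1.2 rule (2)] [cite: KontsevichZagierPeriods2001, §1.2 rule (2)] -/
theorem mem_cubicalCovGens {r r' : IntegralRep n} (hr : r.IsTameCube) (hr' : r'.IsTameCube) {Φ : (Fin n → ℝ) → (Fin n → ℝ)}
    {Φ' : (Fin n → ℝ) → ((Fin n → ℝ) →L[ℝ] (Fin n → ℝ))} (hΦs : IsSemialgebraicMapOn ℚ (cube n) Φ)
    (hΦ' : ∀ x ∈ cube n, HasFDerivWithinAt Φ (Φ' x) (cube n) x) (hinj : Set.InjOn Φ (cube n))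
    (himg : Φ '' cube n = cube n) (hΦa : ∀ i : Fin n, AnalyticOnNhd ℝ (fun x : Fin n → ℝ => Φ x i) (cube n))
    (hf : ∀ x ∈ cube n, r.integrand x = r'.integrand (Φ x) * |(Φ' x).det|) :
    of r - of r' ∈ cubicalCovGens :=
  ⟨n, r, r', Φ, Φ', hr.1, hr.2, hr'.1, hr'.2, hΦs, hΦ', hinj, himg, hΦa, hf, rfl⟩

/-- Introduction rule for the dyadic subdivision move, with tame-cube hypotheses bundled.
[Kontsevich–Zagier 2001, §1.2 rules (1), (2)] [cite: KontsevichZagierPeriods2001, §1.2 rules (1)–(2)] -/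
theorem mem_cubicalSubdivGens {r r₁ r₂ : IntegralRep n} (hr : r.IsTameCube) (h₁ : r₁.IsTameCube) (h₂ : r₂.IsTameCube) (i : Fin n)
    (hf₁ : ∀ x ∈ cube n, r₁.integrand x = (1 / 2 : ℝ) * r.integrand (Function.update x i (x i / 2)))
    (hf₂ : ∀ x ∈ cube n,
      r₂.integrand x = (1 / 2 : ℝ) * r.integrand (Function.update x i ((1 + x i) / 2))) :
    of r - of r₁ - of r₂ ∈ cubicalSubdivGens :=
  ⟨n, r, r₁, r₂, i, hr.1, hr.2, h₁.1, h₁.2, h₂.1, h₂.2, hf₁, hf₂, rfl⟩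

end Intro

/-! ### Three of the four families are moves of the Kontsevich–Zagier calculus -/

/-- The linearity moves on cubes are integrand-additivity moves of the KZ calculus.
[Kontsevich–Zagier 2001, §1.2 rule (1)] [cite: KontsevichZagierPeriods2001, §1.2 rule (1)] -/
theorem cubicalLinGens_subset_integrandAddRel : cubicalLinGens ⊆ integrandAddRel := by
  rintro c ⟨n, r, r₁, r₂, hr, -, hr₁, -, hr₂, -, hadd, rfl⟩
  refine ⟨n, r, r₁, r₂, hr₁.trans hr.symm, hr₂.trans hr.symm, ?_, rfl⟩
  rw [hr]
  exact hadd

/-- The linearity moves on cubes are relations of the KZ calculus.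
[Kontsevich–Zagier 2001, §1.2 rule (1)] [cite: KontsevichZagierPeriods2001, §1.2 rule (1)] -/
theorem cubicalLinGens_subset_relations : cubicalLinGens ⊆ (relations : Set FormalRep) :=
  cubicalLinGens_subset_integrandAddRel.trans integrandAddRel_subset_relations

/-- The change-of-variables moves along self-maps of the cube are change-of-variables moves of the
KZ calculus (`r'.domain = cube n = Φ '' cube n = Φ '' r.domain`).
[Kontsevich–Zagier 2001, §1.2 rule (2)] [cite: KontsevichZagierPeriods2001, §1.2 rule (2)] -/
theorem cubicalCovGens_subset_changeOfVariablesRel : cubicalCovGens ⊆ changeOfVariablesRel := by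
  rintro c ⟨n, r, r', Φ, Φ', hr, -, hr', -, hΦ, hΦ', hinj, himg, -, hf, rfl⟩
  refine ⟨n, r, r', Φ, Φ', ?_, ?_, ?_, ?_, ?_, rfl⟩
  · rw [hr]; exact hΦ
  · rw [hr]; exact hΦ'
  · rw [hr]; exact hinj
  · rw [hr, hr', himg]
  · rw [hr]; exact hf

/-- The change-of-variables moves along self-maps of the cube are relations of the KZ calculus.
[Kontsevich–Zagier 2001, §1.2 rule (2)] [cite: KontsevichZagierPeriods2001, §1.2 rule (2)] -/
theorem cubicalCovGens_subset_relations : cubicalCovGens ⊆ (relations : Set FormalRep) :=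
  cubicalCovGens_subset_changeOfVariablesRel.trans changeOfVariablesRel_subset_relations

/-- The Newton–Leibniz moves along the last coordinate of the cube are Newton–Leibniz moves of the KZ
calculus, with base `τ = [0,1]ⁿ` and the constant (polynomial, hence `ℚ`-semialgebraic) bounds
`a = 0 ≤ b = 1`: the band is `[0,1]ⁿ⁺¹` (`KZ.cube_succ_eq`), continuity of `t ↦ F (x, t)` on `[0,1]`
follows from its differentiability there, and the derivative hypothesis on `(0,1)` from the one on
`[0,1]`. [Kontsevich–Zagier 2001, §1.2 rule (3); Ayoub 2014, Def. 10] [cite: KontsevichZagierPeriods2001, §1.2 rule (3)] -/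
theorem cubicalStokesGens_subset_newtonLeibnizRel : cubicalStokesGens ⊆ newtonLeibnizRel := by
  rintro c ⟨n, r, r', F, hr, -, hr', -, -, hF, hderiv, hr'F, rfl⟩
  have hsa : IsSemialgebraic ℚ (cube n) := hr' ▸ r'.isSemialgebraic_domain
  have h0 : IsSemialgebraicFunOn ℚ (cube n) (fun _ : Fin n → ℝ => (0 : ℝ)) := by
    simpa using isSemialgebraicFunOn_aeval (R := ℝ) hsa (0 : MvPolynomial (Fin n) ℚ)
  have h1 : IsSemialgebraicFunOn ℚ (cube n) (fun _ : Fin n → ℝ => (1 : ℝ)) := by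
    simpa using isSemialgebraicFunOn_aeval (R := ℝ) hsa (1 : MvPolynomial (Fin n) ℚ)
  refine ⟨n, r, r', fun _ => 0, fun _ => 1, F, ?_, ?_, ?_, ?_, ?_, ?_, ?_, ?_, rfl⟩
  · rw [hr]; exact hF
  · rw [hr']; exact h0
  · rw [hr']; exact h1
  · intro x _; exact zero_le_one
  · rw [hr, hr']; exact cube_succ_eq n
  · intro x hx
    rw [hr'] at hx
    exact HasDerivAt.continuousOn fun t ht => hderiv x hx t ht
  · intro x hx t ht
    rw [hr'] at hx
    exact hderiv x hx t (Ioo_subset_Icc_self ht)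
  · intro x hx
    rw [hr'] at hx
    exact hr'F x hx

/-- The Newton–Leibniz moves along the last coordinate of the cube are relations of the KZ calculus.
[Kontsevich–Zagier 2001, §1.2 rule (3)] [cite: KontsevichZagierPeriods2001, §1.2 rule (3)] -/
theorem cubicalStokesGens_subset_relations : cubicalStokesGens ⊆ (relations : Set FormalRep) :=
  cubicalStokesGens_subset_newtonLeibnizRel.trans newtonLeibnizRel_subset_relations

/-- Reduction of the soundness of the cubical span to the subdivision family: since the other three
families are moves of the KZ calculus, `cubicalSpan ≤ relations` holds as soon as the subdivision
moves are relations. [Kontsevich–Zagier 2001, §1.2] [cite: KontsevichZagierPeriods2001, §1.2] -/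
theorem cubicalSpan_le_relations_of_subdiv
    (h : cubicalSubdivGens ⊆ (relations : Set FormalRep)) : cubicalSpan ≤ relations :=
  cubicalSpan_le_iff.mpr ⟨cubicalLinGens_subset_relations, cubicalStokesGens_subset_relations,
    cubicalCovGens_subset_relations, h⟩

/-! ### The subdivision moves are relations of the Kontsevich–Zagier calculus

Dyadic subdivision along the coordinate `i` is a composite of three moves of `KZCalculus.lean`:
domain additivity (rule (1)) for `[0,1]ⁿ = {xᵢ ≤ ½} ∪ {½ ≤ xᵢ}` (the overlap lies in the null
hyperplane `xᵢ = ½`), and two changes of variables (rule (2)) along the affine rescalings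
`x ↦ (x with xᵢ ↦ xᵢ/2)`, `x ↦ (x with xᵢ ↦ (1 + xᵢ)/2)` of the cube onto the two halves, of Jacobian
`½`. -/

section Subdiv

variable (i : Fin n)

/-- The lower half `{x ∈ [0,1]ⁿ | xᵢ ≤ ½}` of the cube along the coordinate `i`. [folklore] -/
def lowerHalfCube (i : Fin n) : Set (Fin n → ℝ) := {x | x ∈ cube n ∧ x i ≤ 1 / 2}

/-- The upper half `{x ∈ [0,1]ⁿ | ½ ≤ xᵢ}` of the cube along the coordinate `i`. [folklore] -/
def upperHalfCube (i : Fin n) : Set (Fin n → ℝ) := {x | x ∈ cube n ∧ 1 / 2 ≤ x i}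

/-- Membership in the lower half cube. [folklore] -/
theorem mem_lowerHalfCube {x : Fin n → ℝ} : x ∈ lowerHalfCube i ↔ x ∈ cube n ∧ x i ≤ 1 / 2 :=
  Iff.rfl

/-- Membership in the upper half cube. [folklore] -/
theorem mem_upperHalfCube {x : Fin n → ℝ} : x ∈ upperHalfCube i ↔ x ∈ cube n ∧ 1 / 2 ≤ x i :=
  Iff.rfl

/-- The lower half cube lies in the cube. [folklore] -/
theorem lowerHalfCube_subset : lowerHalfCube i ⊆ cube n := fun _ hx => hx.1

/-- The upper half cube lies in the cube. [folklore] -/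
theorem upperHalfCube_subset : upperHalfCube i ⊆ cube n := fun _ hx => hx.1

/-- The cube is the union of its two halves along any coordinate. [folklore] -/
theorem lowerHalfCube_union_upperHalfCube : lowerHalfCube i ∪ upperHalfCube i = cube n := by
  ext x
  simp only [mem_union, mem_lowerHalfCube, mem_upperHalfCube]
  constructor
  · rintro (h | h) <;> exact h.1
  · intro h
    rcases le_total (x i) (1 / 2) with h' | h'
    · exact Or.inl ⟨h, h'⟩
    · exact Or.inr ⟨h, h'⟩

/-- The two halves overlap in a Lebesgue-null set (a piece of the hyperplane `xᵢ = ½`).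
[folklore] -/
theorem volume_lowerHalfCube_inter_upperHalfCube :
    volume (lowerHalfCube i ∩ upperHalfCube i) = 0 := by
  have h : lowerHalfCube i ∩ upperHalfCube i ⊆ {x : Fin n → ℝ | x i = 1 / 2} :=
    fun x hx => le_antisymm hx.1.2 hx.2.2
  exact measure_mono_null h (Measure.pi_hyperplane (fun _ : Fin n => (volume : Measure ℝ)) i _)

/-- The lower half cube is `ℚ`-semialgebraic. [folklore] -/
theorem isSemialgebraic_lowerHalfCube : IsSemialgebraic ℚ (lowerHalfCube i) := by
  have h : lowerHalfCube i =
      cube n ∩ {x : Fin n → ℝ | aeval x (X i : MvPolynomial (Fin n) ℚ) ≤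
        aeval x (C (1 / 2 : ℚ) : MvPolynomial (Fin n) ℚ)} := by
    ext x
    simp [mem_lowerHalfCube]
  rw [h]
  exact isSemialgebraic_cube.inter
    (Literature.ModelTheory.ExponentialFields.isSemialgebraic_setOf_eval_le _ _)

/-- The upper half cube is `ℚ`-semialgebraic. [folklore] -/
theorem isSemialgebraic_upperHalfCube : IsSemialgebraic ℚ (upperHalfCube i) := by
  have h : upperHalfCube i =
      cube n ∩ {x : Fin n → ℝ | aeval x (C (1 / 2 : ℚ) : MvPolynomial (Fin n) ℚ) ≤
        aeval x (X i : MvPolynomial (Fin n) ℚ)} := by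
    ext x
    simp [mem_upperHalfCube]
  rw [h]
  exact isSemialgebraic_cube.inter
    (Literature.ModelTheory.ExponentialFields.isSemialgebraic_setOf_eval_le _ _)

/-- The linear rescaling `v ↦ (v with vᵢ ↦ vᵢ/2)` as a continuous linear map (the common derivative of
the two subdivision maps), realised as the diagonal matrix `diag(1, …, ½, …, 1)`. [folklore] -/
def halfScaleCLM (i : Fin n) : (Fin n → ℝ) →L[ℝ] (Fin n → ℝ) :=
  LinearMap.toContinuousLinearMap
    (Matrix.toLin' (Matrix.diagonal fun j : Fin n => if j = i then (1 / 2 : ℝ) else 1))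

/-- `halfScaleCLM i v = (v with vᵢ ↦ vᵢ/2)`. [folklore] -/
theorem halfScaleCLM_apply (v : Fin n → ℝ) :
    halfScaleCLM i v = Function.update v i (v i / 2) := by
  ext j
  simp only [halfScaleCLM, LinearMap.coe_toContinuousLinearMap', Matrix.toLin'_apply,
    Matrix.mulVec_diagonal]
  by_cases hj : j = i
  · subst hj; simp; ring
  · simp [hj]

/-- The Jacobian determinant of the rescaling is `½`. [folklore] -/
theorem det_halfScaleCLM : (halfScaleCLM i).det = 1 / 2 := by
  simp [halfScaleCLM, LinearMap.det_toLin', Matrix.det_diagonal, Finset.prod_ite_eq']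

/-- The lower subdivision map `x ↦ (x with xᵢ ↦ xᵢ/2)`. [folklore] -/
def lowerHalfMap (i : Fin n) (x : Fin n → ℝ) : Fin n → ℝ := Function.update x i (x i / 2)

/-- The upper subdivision map `x ↦ (x with xᵢ ↦ (1 + xᵢ)/2)`. [folklore] -/
def upperHalfMap (i : Fin n) (x : Fin n → ℝ) : Fin n → ℝ := Function.update x i ((1 + x i) / 2)

/-- The lower subdivision map is the linear rescaling. [folklore] -/
theorem lowerHalfMap_eq_halfScaleCLM : lowerHalfMap i = ⇑(halfScaleCLM i) :=
  funext fun v => (halfScaleCLM_apply i v).symm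

/-- The upper subdivision map is the linear rescaling followed by the translation by `½ eᵢ`.
[folklore] -/
theorem upperHalfMap_eq_halfScaleCLM_add :
    upperHalfMap i = fun x => halfScaleCLM i x + Pi.single i (1 / 2 : ℝ) := by
  funext x
  ext j
  rw [halfScaleCLM_apply]
  by_cases hj : j = i
  · subst hj; simp [upperHalfMap]; ring
  · simp [upperHalfMap, hj]

/-- The lower subdivision map has derivative the rescaling, within any set. [folklore] -/
theorem hasFDerivWithinAt_lowerHalfMap (s : Set (Fin n → ℝ)) (x : Fin n → ℝ) :
    HasFDerivWithinAt (lowerHalfMap i) (halfScaleCLM i) s x := by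
  rw [lowerHalfMap_eq_halfScaleCLM]
  exact (halfScaleCLM i).hasFDerivWithinAt

/-- The upper subdivision map has derivative the rescaling, within any set. [folklore] -/
theorem hasFDerivWithinAt_upperHalfMap (s : Set (Fin n → ℝ)) (x : Fin n → ℝ) :
    HasFDerivWithinAt (upperHalfMap i) (halfScaleCLM i) s x := by
  rw [upperHalfMap_eq_halfScaleCLM_add]
  exact (halfScaleCLM i).hasFDerivWithinAt.add_const _

/-- The lower subdivision map is injective. [folklore] -/
theorem lowerHalfMap_injective : Function.Injective (lowerHalfMap i) := by
  intro x y h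
  ext j
  have hj := congr_fun h j
  by_cases hji : j = i
  · subst hji
    simp only [lowerHalfMap, Function.update_self] at hj
    linarith
  · simpa [lowerHalfMap, Function.update_of_ne hji] using hj

/-- The upper subdivision map is injective. [folklore] -/
theorem upperHalfMap_injective : Function.Injective (upperHalfMap i) := by
  intro x y h
  ext j
  have hj := congr_fun h j
  by_cases hji : j = i
  · subst hji
    simp only [upperHalfMap, Function.update_self] at hj
    linarith
  · simpa [upperHalfMap, Function.update_of_ne hji] using hj

/-- The lower subdivision map sends the cube onto its lower half. [folklore] -/
theorem image_lowerHalfMap_cube : lowerHalfMap i '' cube n = lowerHalfCube i := by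
  ext y
  simp only [mem_image, mem_lowerHalfCube]
  constructor
  · rintro ⟨x, hx, rfl⟩
    have hxi := mem_cube.1 hx i
    refine ⟨update_mem_cube hx i (by linarith) (by linarith), ?_⟩
    simp only [lowerHalfMap, Function.update_self]
    linarith
  · rintro ⟨hy, hyi⟩
    have hyi' := mem_cube.1 hy i
    refine ⟨Function.update y i (2 * y i), update_mem_cube hy i (by linarith) (by linarith), ?_⟩
    ext j
    by_cases hji : j = i
    · subst hji
      simp only [lowerHalfMap, Function.update_self]
      ring
    · simp [lowerHalfMap, Function.update_of_ne hji]

/-- The upper subdivision map sends the cube onto its upper half. [folklore] -/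
theorem image_upperHalfMap_cube : upperHalfMap i '' cube n = upperHalfCube i := by
  ext y
  simp only [mem_image, mem_upperHalfCube]
  constructor
  · rintro ⟨x, hx, rfl⟩
    have hxi := mem_cube.1 hx i
    refine ⟨update_mem_cube hx i (by linarith) (by linarith), ?_⟩
    simp only [upperHalfMap, Function.update_self]
    linarith
  · rintro ⟨hy, hyi⟩
    have hyi' := mem_cube.1 hy i
    refine ⟨Function.update y i (2 * y i - 1), update_mem_cube hy i (by linarith) (by linarith), ?_⟩
    ext j
    by_cases hji : j = i
    · subst hji
      simp only [upperHalfMap, Function.update_self]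
      ring
    · simp [upperHalfMap, Function.update_of_ne hji]

/-- The lower subdivision map is a polynomial map over `ℚ`, hence `ℚ`-semialgebraic on the cube.
[BCR 1998, §2.2] [folklore] -/
theorem isSemialgebraicMapOn_lowerHalfMap : IsSemialgebraicMapOn ℚ (cube n) (lowerHalfMap i) := by
  refine (isSemialgebraicMapOn_aeval (R := ℝ) isSemialgebraic_cube fun j : Fin n =>
    if j = i then C (1 / 2 : ℚ) * X i else (X j : MvPolynomial (Fin n) ℚ)).congr fun x _ => ?_
  ext j
  by_cases hji : j = i
  · subst hji
    simp [lowerHalfMap]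
    ring
  · simp [lowerHalfMap, hji]

/-- The upper subdivision map is a polynomial map over `ℚ`, hence `ℚ`-semialgebraic on the cube.
[BCR 1998, §2.2] [folklore] -/
theorem isSemialgebraicMapOn_upperHalfMap : IsSemialgebraicMapOn ℚ (cube n) (upperHalfMap i) := by
  refine (isSemialgebraicMapOn_aeval (R := ℝ) isSemialgebraic_cube fun j : Fin n =>
    if j = i then C (1 / 2 : ℚ) * (1 + X i) else (X j : MvPolynomial (Fin n) ℚ)).congr fun x _ => ?_
  ext j
  by_cases hji : j = i
  · subst hji
    simp [upperHalfMap]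
    ring
  · simp [upperHalfMap, hji]

variable {i}

/-- **The subdivision moves are relations of the KZ calculus**: `[r] − [r₁] − [r₂]` is the sum of the
domain-additivity move `[r] − [r|_{xᵢ≤½}] − [r|_{½≤xᵢ}]` (overlap null) and the two
change-of-variables moves `[r₁] − [r|_{xᵢ≤½}]`, `[r₂] − [r|_{½≤xᵢ}]` along the affine rescalings of
Jacobian `½`. [Kontsevich–Zagier 2001, §1.2 rules (1), (2)] [cite: KontsevichZagierPeriods2001, §1.2 rules (1)–(2)] -/
theorem cubicalSubdivGens_subset_relations : cubicalSubdivGens ⊆ (relations : Set FormalRep) := by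
  rintro c ⟨n, r, r₁, r₂, i, hr, -, hr₁, -, hr₂, -, hf₁, hf₂, rfl⟩
  -- the two halves of `r`
  have hLsub : lowerHalfCube i ⊆ r.domain := hr ▸ lowerHalfCube_subset i
  have hUsub : upperHalfCube i ⊆ r.domain := hr ▸ upperHalfCube_subset i
  set rL : IntegralRep n := r.restrict (lowerHalfCube i) (isSemialgebraic_lowerHalfCube i) hLsub
    with hrL
  set rU : IntegralRep n := r.restrict (upperHalfCube i) (isSemialgebraic_upperHalfCube i) hUsub
    with hrU
  -- move (1a): `[r] − [rL] − [rU]`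
  have hadd : of r - of rL - of rU ∈ relations := by
    refine domainAddRel_subset_relations ⟨n, r, rL, rU, ?_, ?_, ?_, ?_, rfl⟩
    · rw [hr, hrL, hrU, IntegralRep.domain_restrict, IntegralRep.domain_restrict,
        lowerHalfCube_union_upperHalfCube]
    · rw [hrL, hrU, IntegralRep.domain_restrict, IntegralRep.domain_restrict]
      exact volume_lowerHalfCube_inter_upperHalfCube i
    · exact fun _ _ => rfl
    · exact fun _ _ => rfl
  -- move (2) for the lower half: `[r₁] − [rL]`
  have hcov₁ : of r₁ - of rL ∈ relations := by
    refine changeOfVariablesRel_subset_relations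
      ⟨n, r₁, rL, lowerHalfMap i, fun _ => halfScaleCLM i, ?_, ?_, ?_, ?_, ?_, rfl⟩
    · rw [hr₁]; exact isSemialgebraicMapOn_lowerHalfMap i
    · rw [hr₁]; exact fun x _ => hasFDerivWithinAt_lowerHalfMap i _ x
    · exact (lowerHalfMap_injective i).injOn
    · rw [hr₁, hrL, IntegralRep.domain_restrict, image_lowerHalfMap_cube]
    · intro x hx
      rw [hr₁] at hx
      rw [hf₁ x hx, hrL, IntegralRep.integrand_restrict, det_halfScaleCLM,
        abs_of_pos (by norm_num : (0 : ℝ) < 1 / 2), mul_comm]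
      rfl
  -- move (2) for the upper half: `[r₂] − [rU]`
  have hcov₂ : of r₂ - of rU ∈ relations := by
    refine changeOfVariablesRel_subset_relations
      ⟨n, r₂, rU, upperHalfMap i, fun _ => halfScaleCLM i, ?_, ?_, ?_, ?_, ?_, rfl⟩
    · rw [hr₂]; exact isSemialgebraicMapOn_upperHalfMap i
    · rw [hr₂]; exact fun x _ => hasFDerivWithinAt_upperHalfMap i _ x
    · exact (upperHalfMap_injective i).injOn
    · rw [hr₂, hrU, IntegralRep.domain_restrict, image_upperHalfMap_cube]
    · intro x hx
      rw [hr₂] at hx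
      rw [hf₂ x hx, hrU, IntegralRep.integrand_restrict, det_halfScaleCLM,
        abs_of_pos (by norm_num : (0 : ℝ) < 1 / 2), mul_comm]
      rfl
  have heq : of r - of r₁ - of r₂ = (of r - of rL - of rU) - (of r₁ - of rL) - (of r₂ - of rU) := by
    abel
  rw [heq]
  exact relations.sub_mem (relations.sub_mem hadd hcov₁) hcov₂

end Subdiv

/-- **Soundness of the cubical sub-calculus**: the cubical span lies in the subgroup of relations of
the Kontsevich–Zagier calculus (each of the four families consists of moves, or sums of moves, of
`KZCalculus.lean`), hence in the kernel of evaluation (`KZ.relations_le_ker_eval_holds`). This is,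
definitionally, the registered stub `stub_cubicalSound` of crux `ReducedPeriodRing`.
[Kontsevich–Zagier 2001, §1.2] [cite: KontsevichZagierPeriods2001, §1.2] -/
theorem cubicalSpan_le_relations : cubicalSpan ≤ relations :=
  cubicalSpan_le_relations_of_subdiv cubicalSubdivGens_subset_relations

/-- Every element of the cubical span evaluates to `0`. [Kontsevich–Zagier 2001, §1.2] [cite: KontsevichZagierPeriods2001, §1.2] -/
theorem eval_eq_zero_of_mem_cubicalSpan {c : FormalRep} (hc : c ∈ cubicalSpan) : eval c = 0 :=
  relations_le_ker_eval_holds (cubicalSpan_le_relations hc)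

end KZ

end Literature.NumberTheory.Transcendental
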